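import Summits.ABC.IUTFork.Thm311RealInd2Ism
import Literature.AnabelianGeometry.AbsoluteAnabelian.MLFNormUnitSubgroups
import HarnessLib

/-!
# [IUTchIII] Theorem 3.11 (i) (Ind2), print-literal at `𝕍^non`: NORM RIGIDITY — a `G_v`-isometry FIXES the image
# under `log_v` of EVERY open subgroup of `𝒪_v^×` (so print's (Ind2) cannot shear a lattice)

Record file (D-0012) of the abc-iut cell (seat abc-iut-c312-1, holder of record of the typed [IUTchIII] Thm. 3.11,
gen 7); sequel of `Thm311RealInd2Ism.lean`; TAKES NO SIDE on [IUTchIII] Cor. 3.12.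

[IUTchII] Example 1.8 (iv) (kurims p. 39) defines `Ism(G)` by two conditions: `G`-EQUIVARIANCE on `O^{×μ}(G)` and
preservation of the lattice `Im(O^×(G)^H)` for EVERY OPEN `H ⊆ G`.  For the genuine pair `(G_v ↷ 𝒪_{K̄_v}^×)` these
two conditions interact through the NORM: for a finite Galois `E/K_v` (`H = G_E`, open) an isometry `φ` carries
`Im(𝒪_E^×)` onto itself and commutes with `Gal(E/K_v)`, hence carries the norm lattice `Im(N_{E/K_v}(𝒪_E^×)) ⊆ Im(𝒪_v^×)`
onto itself (this lineage's `map_normLattice_eq_of_mem_isometryGroup`, `KummerStructuresIsometryNorms`).  By local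
class field theory (the tree's DISCHARGED existence theorem `localExistenceTheorem_holds`, Serre *Local Fields*
XIV §6 Thm. 1, in the units form `exists_abelian_norm_unitSubmonoid_eq` of this lineage's `MLFNormUnitSubgroups`)
EVERY open subgroup `U₀ ≤ 𝒪_v^×` is such a norm lattice.  Consequently:

* **`Real.exists_mem_apply_clsOf_eq`, `Real.exists_mem_clsOf_eq_apply`** — an isometry `φ ∈ Ism(G_v)` permutes the
  classes `{[u] : u ∈ U₀}` of every open subgroup `U₀ ≤ 𝒪_v^×`;
* **`Real.image_log_eq_of_realises`** — every automorphism `ψ` of `K_v` realising `φ` through a logarithm `L`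
  (print's (Ind2) at `v`, `Real.ismIsmOf`) satisfies `ψ(L(U₀)) = L(U₀)` for every such `U₀`: print's (Ind2) FIXES
  the `log_v`-image of every open subgroup of units — in particular (taking `U₀ ⊇ (𝒪_v^×)^{p^m}`) every sub-lattice
  `M` with `p^m·log_v(𝒪_v^×) ⊆ M ⊆ log_v(𝒪_v^×)` whose unit preimage is open (`Real.image_eq_of_realises_of_le_range`),
  so it moves NO lattice "direction": the lattice shears of `GL_{ℤ_p}(I_v)` available in Dupuy–Hilado's reading
  (`Real.ismDH`; e.g. abc-iut-c312-3's shallow-ramified licence mover `1 ↦ π/p`, abc-iut-c312-5's F-c312-5-g4-1) are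
  NOT in print's group.  (The openness input is kept as an explicit hypothesis on the unit subgroup; for the
  analytic logarithm it holds for every `M ⊇ p^m·log_v(𝒪_v^×)` since `(𝒪_v^×)^{p^m}` is open — Hensel, sequel.)

HONEST SCOPE: theorems about OUR typed objects (L4 `MLFClosure`/`unitSubmonoid`, L6-t2 `isometryGroup`, L6-d2's
genuine action, c312-5's real shells) plus classical local class field theory; Mochizuki's «compact topological
group Ism(G)» is read with topologies suppressed exactly as abc-iut-L6-t2 typed it; nothing here asserts or refutes
[IUTchIII] Cor. 3.12; no side taken. [claim: Mochizuki2012, status: disputed] for the quotations;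
[cite: SerreLocalFields1979, Ch. XIV §6 Thm. 1]. typed ≠ proved; instantiated ≠ endorsed.
-/

set_option autoImplicit false

noncomputable section

namespace Summit.ABC.IUTFork.Thm311.Real

open NumberField IsDedekindDomain Literature.IUT.LogVolume Literature.IUT.LogThetaLattice
open Literature.AnabelianGeometry.AbsoluteAnabelian Literature.IUT.HodgeArakelov
open Literature.IUT.HodgeArakelov.AbsTopMonoids Literature.NumberTheory.GaloisRepresentations

variable {F : Type} [Field F] [NumberField F] (v : HeightOneSpectrum (𝓞 F))

/-! ## 1. Finite Galois levels: `O^×(G_v)^{G_E} = 𝒪_E^×` and the norm -/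

section Levels

variable (E : IntermediateField (v.adicCompletion F) (AlgebraicClosure (v.adicCompletion F)))

/-- Underlying element of `K̄_v` of a unit `x ∈ O^×(G_v)`. [folklore] -/
abbrev val (x : OUnits v) : AlgebraicClosure (v.adicCompletion F) :=
  ((x : nonzeroIntegers (v.adicCompletion F) (AlgebraicClosure (v.adicCompletion F))) : AlgebraicClosure (v.adicCompletion F))

/-- `val` is multiplicative. [folklore] -/
theorem val_mul (x y : OUnits v) : val v (x * y) = val v x * val v y := rfl

/-- `val` of a finite product. [folklore] -/
theorem val_prod {ι : Type} (s : Finset ι) (f : ι → OUnits v) : val v (∏ i ∈ s, f i) = ∏ i ∈ s, val v (f i) := by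
  classical
  induction s using Finset.induction_on with
  | empty => rfl
  | insert a s ha ih => rw [Finset.prod_insert ha, Finset.prod_insert ha, val_mul, ih]

/-- `val x` is a unit of `𝒪_{K̄_v}` (abc-iut-L4-t2's `unitSubmonoid`). [cite: MochizukiAbsTopIII2015, Definition 3.1 (i) p.66] -/
theorem val_mem_unitSubmonoid (x : OUnits v) :
    val v x ∈ unitSubmonoid (v.adicCompletion F) (AlgebraicClosure (v.adicCompletion F)) := by
  have h := (Genuine.unitsBridge (closureAt v) x).2
  rw [mem_unitGroup_iff, Genuine.coe_unitsBridge] at h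
  exact h

/-- `val` is injective. [folklore] -/
theorem val_injective : Function.Injective (val (F := F) v) := fun _ _ h => Units.ext (Subtype.ext h)

/-- `val (toOUnits v u) = algebraMap K_v K̄_v u`. [folklore] -/
theorem val_toOUnits (u : (↥(v.adicCompletionIntegers F))ˣ) :
    val v (toOUnits v u) = algebraMap (v.adicCompletion F) (AlgebraicClosure (v.adicCompletion F))
      ((u : ↥(v.adicCompletionIntegers F)) : v.adicCompletion F) := by
  change val v ((Genuine.unitsBridge (closureAt v)).symm (unitOfIntegers v u)) = _
  unfold val
  rw [Genuine.coe_unitsBridge_symm, coe_unitOfIntegers]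

/-- For a finite `E/K_v`, `G_E := Gal(K̄_v/E)` is an OPEN subgroup of `G_v` (Krull topology).
[claim: Mochizuki2012, status: disputed] -/
theorem fixingSubgroup_mem_openSubgroups [FiniteDimensional (v.adicCompletion F) E] :
    E.fixingSubgroup ∈ openSubgroups v :=
  E.fixingSubgroup_isOpen

/-- **`O^×(G_v)^{G_E}` = the units of `K̄_v` lying in `E`** (infinite Galois correspondence, characteristic `0`).
[cite: MochizukiAbsTopIII2015, Definition 3.1 (iv) p.69] -/
theorem mem_fixedBy_fixingSubgroup_iff (x : OUnits v) : x ∈ fixedBy (galRho v) E.fixingSubgroup ↔ val v x ∈ E := by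
  haveI := Literature.NumberTheory.GaloisRepresentations.charZero_adicCompletion v
  haveI : IsGalois (v.adicCompletion F) (AlgebraicClosure (v.adicCompletion F)) := {}
  constructor
  · intro hx
    have hmem : val v x ∈ IntermediateField.fixedField E.fixingSubgroup := by
      rw [IntermediateField.mem_fixedField_iff]
      intro σ hσ
      have h := congrArg (val v) (hx σ hσ)
      rw [show val v (galRho v σ x) = σ (val v x) from coe_galRho v σ x] at h
      exact h
    rwa [InfiniteGalois.fixedField_fixingSubgroup] at hmem
  · intro hx
    rw [mem_fixedBy]
    intro σ hσ
    apply val_injective v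
    rw [show val v (galRho v σ x) = σ (val v x) from coe_galRho v σ x]
    exact (IntermediateField.mem_fixingSubgroup_iff _ _).mp hσ _ hx

variable [FiniteDimensional (v.adicCompletion F) E] [IsGalois (v.adicCompletion F) E]

omit [FiniteDimensional (v.adicCompletion F) E] in
/-- Restriction `G_v → Gal(E/K_v)` is onto (`E/K_v` normal). [folklore] -/
theorem restrictNormalHom_surjective' :
    Function.Surjective (AlgEquiv.restrictNormalHom (F := v.adicCompletion F)
      (K₁ := AlgebraicClosure (v.adicCompletion F)) E) :=
  AlgEquiv.restrictNormalHom_surjective (F := v.adicCompletion F) (K₁ := E)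
    (E := AlgebraicClosure (v.adicCompletion F))

open Classical in
/-- A set of lifts to `G_v` of the elements of `Gal(E/K_v)` (a section of the restriction map, which is onto).
[folklore] -/
def lifts : Finset (Gal v) :=
  Finset.univ.image fun σ : E ≃ₐ[v.adicCompletion F] E => Function.surjInv (restrictNormalHom_surjective' v E) σ

/-- **The norm along the lifts is the field norm**: for `y ∈ E`, `∏_{t ∈ lifts} t(y) = N_{E/K_v}(y)` in `K̄_v`.
[folklore] -/
theorem prod_lifts_apply (y : E) :
    ∏ t ∈ lifts v E, t (y : AlgebraicClosure (v.adicCompletion F)) =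
      algebraMap (v.adicCompletion F) (AlgebraicClosure (v.adicCompletion F)) (Algebra.norm (v.adicCompletion F) y) := by
  classical
  set s := fun σ : E ≃ₐ[v.adicCompletion F] E => Function.surjInv (restrictNormalHom_surjective' v E) σ with hs_def
  have hs : ∀ σ, AlgEquiv.restrictNormalHom E (s σ) = σ := fun σ =>
    Function.surjInv_eq (restrictNormalHom_surjective' v E) σ
  have hinj : Function.Injective s := Function.injective_surjInv _
  rw [lifts, Finset.prod_image fun a _ b _ h => hinj h]
  have key : ∀ σ : E ≃ₐ[v.adicCompletion F] E,
      s σ (y : AlgebraicClosure (v.adicCompletion F)) = ((σ y : E) : AlgebraicClosure (v.adicCompletion F)) := by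
    intro σ
    rw [← AlgEquiv.restrictNormalHom_apply E (s σ) y, hs σ]
  simp_rw [key]
  rw [← Submonoid.coe_finsetProd, IsScalarTower.algebraMap_apply (v.adicCompletion F) E
    (AlgebraicClosure (v.adicCompletion F)), Algebra.norm_eq_prod_automorphisms]
  rfl

/-- The value of the norm `N_T x` (`T = lifts`) of `x ∈ O^×(G_v)^{G_E}` is `N_{E/K_v}(val x)`.
[claim: Mochizuki2012, status: disputed] -/
theorem val_normMap_lifts {x : OUnits v} (hx : val v x ∈ E) :
    val v (normMap (galRho v) (lifts v E) x) =
      algebraMap (v.adicCompletion F) (AlgebraicClosure (v.adicCompletion F))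
        (Algebra.norm (v.adicCompletion F) (⟨val v x, hx⟩ : E)) := by
  rw [normMap_apply, val_prod, ← prod_lifts_apply v E ⟨val v x, hx⟩]
  refine Finset.prod_congr rfl fun t _ => ?_
  exact coe_galRho v t x

end Levels

/-! ## 2. Open unit subgroups are norm lattices: an isometry permutes their classes -/

section OpenUnits

/-- The image in `K_v^×` of a subgroup of `𝒪_v^×`. [folklore] -/
def unitsToK : (↥(v.adicCompletionIntegers F))ˣ →* (v.adicCompletion F)ˣ :=
  Units.map (v.adicCompletionIntegers F).subtype.toMonoidHom

/-- `unitsToK u = u` on underlying elements. [folklore] -/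
@[simp] theorem coe_unitsToK (u : (↥(v.adicCompletionIntegers F))ˣ) :
    ((unitsToK v u : (v.adicCompletion F)ˣ) : v.adicCompletion F) = ((u : ↥(v.adicCompletionIntegers F)) : v.adicCompletion F) :=
  rfl

/-- `unitsToK` is injective. [folklore] -/
theorem unitsToK_injective : Function.Injective (unitsToK (F := F) v) := by
  intro a b h
  have := congrArg (fun w : (v.adicCompletion F)ˣ => (w : v.adicCompletion F)) h
  simp only [coe_unitsToK] at this
  exact Units.ext (Subtype.ext this)

/-- The image of `𝒪_v^×` lies in the unit group `{v = 1}` of the valuative relation. [folklore] -/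
theorem map_unitsToK_le (U₀ : Subgroup (↥(v.adicCompletionIntegers F))ˣ) :
    U₀.map (unitsToK v) ≤ (ValuativeRel.valuation (v.adicCompletion F)).valuationSubring.unitGroup := by
  rintro _ ⟨u, _, rfl⟩
  rw [Valuation.mem_unitGroup_iff, coe_unitsToK]
  exact valuation_coe_unit v u

variable {v}

/-- A unit of `K_v^×` of valuation `1` with value `N_{E/K_v}(y)` comes from `𝒪_v^×`: bookkeeping between `K_v^×` and
`𝒪_v^×`. [folklore] -/
theorem exists_unit_coe_eq {x : (v.adicCompletion F)ˣ}
    (hx : x ∈ (ValuativeRel.valuation (v.adicCompletion F)).valuationSubring.unitGroup) :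
    ∃ u : (↥(v.adicCompletionIntegers F))ˣ, unitsToK v u = x := by
  rw [Valuation.mem_unitGroup_iff] at hx
  have hx1 : Valued.v (x : v.adicCompletion F) = 1 :=
    ((ValuativeRel.isEquiv (ValuativeRel.valuation (v.adicCompletion F))
      (Valued.v : Valuation (v.adicCompletion F) (WithZero (Multiplicative ℤ)))).eq_one_iff_eq_one).mp hx
  have hO : (x : v.adicCompletion F) ∈ v.adicCompletionIntegers F := by
    rw [HeightOneSpectrum.mem_adicCompletionIntegers]; exact hx1.le
  have hiO : ((x : v.adicCompletion F))⁻¹ ∈ v.adicCompletionIntegers F := by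
    rw [HeightOneSpectrum.mem_adicCompletionIntegers, map_inv₀, hx1, inv_one]
  refine ⟨⟨⟨x, hO⟩, ⟨(x : v.adicCompletion F)⁻¹, hiO⟩, Subtype.ext (mul_inv_cancel₀ x.ne_zero),
    Subtype.ext (inv_mul_cancel₀ x.ne_zero)⟩, Units.ext rfl⟩

variable (v)
variable (E : IntermediateField (v.adicCompletion F) (AlgebraicClosure (v.adicCompletion F)))
  [FiniteDimensional (v.adicCompletion F) E] [IsGalois (v.adicCompletion F) E]
  (U₀ : Subgroup (↥(v.adicCompletionIntegers F))ˣ)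
  (hE : ∀ x : (v.adicCompletion F)ˣ, x ∈ U₀.map (unitsToK v) ↔
    ∃ y : E, (y : AlgebraicClosure (v.adicCompletion F)) ∈
      unitSubmonoid (v.adicCompletion F) (AlgebraicClosure (v.adicCompletion F)) ∧
      Algebra.norm (v.adicCompletion F) y = (x : v.adicCompletion F))

include hE

/-- If `U₀ = N_{E/K_v}(𝒪_E^×)`, every `u ∈ U₀` is a norm `N_T x` with `x ∈ O^×(G_v)^{G_E}`. [folklore] -/
theorem exists_fixedBy_normMap_eq {u : (↥(v.adicCompletionIntegers F))ˣ} (hu : u ∈ U₀) :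
    ∃ x ∈ fixedBy (galRho v) E.fixingSubgroup, normMap (galRho v) (lifts v E) x = toOUnits v u := by
  obtain ⟨y, hy, hny⟩ := (hE (unitsToK v u)).mp ⟨u, hu, rfl⟩
  obtain ⟨w, hw⟩ := exists_unitGroup_val_eq hy
  let x : OUnits v := (Genuine.unitsBridge (closureAt v)).symm w
  have hvx : val v x = (y : AlgebraicClosure (v.adicCompletion F)) := by
    change val v ((Genuine.unitsBridge (closureAt v)).symm w) = _
    unfold val; rw [Genuine.coe_unitsBridge_symm]; exact hw
  have hxE : val v x ∈ E := by rw [hvx]; exact y.2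
  refine ⟨x, (mem_fixedBy_fixingSubgroup_iff v E x).mpr hxE, val_injective v ?_⟩
  rw [val_normMap_lifts v E hxE, val_toOUnits, ← coe_unitsToK, ← hny]
  congr 2
  exact Subtype.ext hvx

/-- If `U₀ = N_{E/K_v}(𝒪_E^×)`, every norm `N_T x`, `x ∈ O^×(G_v)^{G_E}`, is `[u]` for some `u ∈ U₀`. [folklore] -/
theorem exists_mem_normMap_eq {x : OUnits v} (hx : x ∈ fixedBy (galRho v) E.fixingSubgroup) :
    ∃ u ∈ U₀, normMap (galRho v) (lifts v E) x = toOUnits v u := by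
  have hxE := (mem_fixedBy_fixingSubgroup_iff v E x).mp hx
  set y : E := ⟨val v x, hxE⟩
  have hy0 : Algebra.norm (v.adicCompletion F) y ≠ 0 := by
    intro h
    have : val v (normMap (galRho v) (lifts v E) x) = 0 := by rw [val_normMap_lifts v E hxE, h, map_zero]
    exact (ne_zero_of_mem_unitSubmonoid (val_mem_unitSubmonoid v _)) this
  have hmem : Units.mk0 _ hy0 ∈ U₀.map (unitsToK v) :=
    (hE _).mpr ⟨y, val_mem_unitSubmonoid v x, rfl⟩
  obtain ⟨u, hu, huy⟩ := hmem
  refine ⟨u, hu, val_injective v ?_⟩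
  rw [val_normMap_lifts v E hxE, val_toOUnits, ← coe_unitsToK, huy, Units.val_mk0]

variable {φ : MulAut (ModTorsion (OUnits v))}

/-- **An isometry permutes the classes of a norm-unit subgroup (forward)**: for `φ ∈ Ism(G_v)` and `u ∈ U₀ =
N_{E/K_v}(𝒪_E^×)` there is `u' ∈ U₀` with `φ[u] = [u']` — norm rigidity (`KummerStructuresIsometryNorms`) at the open
subgroup `G_E`. [claim: Mochizuki2012, status: disputed] -/
theorem exists_mem_apply_clsOf_eq_of_norm (hφ : φ ∈ ismGenuine v) {u : (↥(v.adicCompletionIntegers F))ˣ} (hu : u ∈ U₀) :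
    ∃ u' ∈ U₀, φ (clsOf v u) = clsOf v u' := by
  obtain ⟨x, hx, hNx⟩ := exists_fixedBy_normMap_eq v E U₀ hE hu
  obtain ⟨x', hx', hφx⟩ := exists_fixedBy_apply_mk_normMap_of_mem_isometryGroup hφ
    (fixingSubgroup_mem_openSubgroups v E) (lifts v E) hx
  obtain ⟨u', hu', hNx'⟩ := exists_mem_normMap_eq v E U₀ hE hx'
  refine ⟨u', hu', ?_⟩
  rw [clsOf_eq_mk, clsOf_eq_mk, ← hNx, ← hNx']
  exact hφx

/-- **… (backward)**: every `[u']`, `u' ∈ U₀`, is `φ[u]` for some `u ∈ U₀`. [claim: Mochizuki2012, status: disputed] -/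
theorem exists_mem_clsOf_eq_apply_of_norm (hφ : φ ∈ ismGenuine v) {u' : (↥(v.adicCompletionIntegers F))ˣ} (hu' : u' ∈ U₀) :
    ∃ u ∈ U₀, φ (clsOf v u) = clsOf v u' := by
  obtain ⟨x', hx', hNx'⟩ := exists_fixedBy_normMap_eq v E U₀ hE hu'
  obtain ⟨x, hx, hφx⟩ := exists_fixedBy_mk_normMap_eq_apply_of_mem_isometryGroup hφ
    (fixingSubgroup_mem_openSubgroups v E) (lifts v E) hx'
  obtain ⟨u, hu, hNx⟩ := exists_mem_normMap_eq v E U₀ hE hx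
  refine ⟨u, hu, ?_⟩
  rw [clsOf_eq_mk, clsOf_eq_mk, ← hNx, ← hNx']
  exact hφx

end OpenUnits

/-! ## 3. The rigidity theorems -/

section Rigidity

variable {v}
variable {φ : MulAut (ModTorsion (OUnits v))} (hφ : φ ∈ ismGenuine v)
  (U₀ : Subgroup (↥(v.adicCompletionIntegers F))ˣ) (hopen : IsOpen ((U₀.map (unitsToK v) : Set (v.adicCompletion F)ˣ)))

include hφ hopen

/-- **NORM RIGIDITY OF PRINT'S Ism, units form**: a `G_v`-isometry `φ` of [IUTchII] Ex. 1.8 (iv) permutes the classes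
`{[u] : u ∈ U₀}` of EVERY open subgroup `U₀ ≤ 𝒪_v^×` — forward direction.  (`U₀ = N_{E/K_v}(𝒪_E^×)` for a finite
abelian `E` by the units form of the local existence theorem, `exists_abelian_norm_unitSubmonoid_eq`; then
`exists_mem_apply_clsOf_eq_of_norm`.) [cite: SerreLocalFields1979, Ch. XIV §6 Thm. 1] [claim: Mochizuki2012, status: disputed] -/
theorem exists_mem_apply_clsOf_eq {u : (↥(v.adicCompletionIntegers F))ˣ} (hu : u ∈ U₀) :
    ∃ u' ∈ U₀, φ (clsOf v u) = clsOf v u' := by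
  obtain ⟨E, hfd, hab, hE⟩ := exists_abelian_norm_unitSubmonoid_eq (v.adicCompletion F) (U₀.map (unitsToK v))
    (map_unitsToK_le v U₀) hopen
  haveI := hfd; haveI := hab
  exact exists_mem_apply_clsOf_eq_of_norm v E U₀ hE hφ hu

/-- **NORM RIGIDITY, units form, backward direction.** [cite: SerreLocalFields1979, Ch. XIV §6 Thm. 1] [claim: Mochizuki2012, status: disputed] -/
theorem exists_mem_clsOf_eq_apply {u' : (↥(v.adicCompletionIntegers F))ˣ} (hu' : u' ∈ U₀) :
    ∃ u ∈ U₀, φ (clsOf v u) = clsOf v u' := by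
  obtain ⟨E, hfd, hab, hE⟩ := exists_abelian_norm_unitSubmonoid_eq (v.adicCompletion F) (U₀.map (unitsToK v))
    (map_unitsToK_le v U₀) hopen
  haveI := hfd; haveI := hab
  exact exists_mem_clsOf_eq_apply_of_norm v E U₀ hE hφ hu'

variable (L : Additive (↥(v.adicCompletionIntegers F))ˣ →+ v.adicCompletion F) {ψ : v.adicCompletion F ≃+ v.adicCompletion F}
  (hψ : Realises v L φ ψ)

include hψ

/-- **PRINT'S (Ind2) FIXES THE `log_v`-IMAGE OF EVERY OPEN SUBGROUP OF UNITS**: if `ψ : K_v ⥲ K_v` realises a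
`G_v`-isometry `φ` through the logarithm `L`, then `ψ(L(U₀)) = L(U₀)` for every open `U₀ ≤ 𝒪_v^×`.
[cite: SerreLocalFields1979, Ch. XIV §6 Thm. 1] [claim: Mochizuki2012, status: disputed] -/
theorem image_log_eq_of_realises :
    ψ '' ((fun u : (↥(v.adicCompletionIntegers F))ˣ => L (Additive.ofMul u)) '' (U₀ : Set (↥(v.adicCompletionIntegers F))ˣ)) =
      (fun u : (↥(v.adicCompletionIntegers F))ˣ => L (Additive.ofMul u)) '' (U₀ : Set (↥(v.adicCompletionIntegers F))ˣ) := by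
  apply Set.Subset.antisymm
  · rintro _ ⟨_, ⟨u, hu, rfl⟩, rfl⟩
    obtain ⟨u', hu', h⟩ := exists_mem_apply_clsOf_eq hφ U₀ hopen hu
    exact ⟨u', hu', (hψ u u' h).symm⟩
  · rintro _ ⟨u', hu', rfl⟩
    obtain ⟨u, hu, h⟩ := exists_mem_clsOf_eq_apply hφ U₀ hopen hu'
    exact ⟨L (Additive.ofMul u), ⟨u, hu, rfl⟩, hψ u u' h⟩

end Rigidity

/-! ## 4. Lattice form: sub-lattices of `log_v(𝒪_v^×)` with open unit preimage are FIXED -/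

section Lattice

variable {v}
variable (L : Additive (↥(v.adicCompletionIntegers F))ˣ →+ v.adicCompletion F)

/-- The unit preimage `{u ∈ 𝒪_v^× : L u ∈ M}` of an additive subgroup `M ⊆ K_v`. [folklore] -/
def unitPreimage (M : AddSubgroup (v.adicCompletion F)) : Subgroup (↥(v.adicCompletionIntegers F))ˣ where
  carrier := {u | L (Additive.ofMul u) ∈ M}
  one_mem' := by
    change L (Additive.ofMul 1) ∈ M
    rw [ofMul_one, map_zero]; exact M.zero_mem
  mul_mem' {a b} ha hb := by
    change L (Additive.ofMul (a * b)) ∈ M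
    rw [ofMul_mul, map_add]; exact M.add_mem ha hb
  inv_mem' {a} ha := by
    change L (Additive.ofMul a⁻¹) ∈ M
    rw [ofMul_inv, map_neg]; exact M.neg_mem ha

/-- Membership in the unit preimage. [folklore] -/
@[simp] theorem mem_unitPreimage_iff (M : AddSubgroup (v.adicCompletion F)) (u : (↥(v.adicCompletionIntegers F))ˣ) :
    u ∈ unitPreimage L M ↔ L (Additive.ofMul u) ∈ M := Iff.rfl

variable {φ : MulAut (ModTorsion (OUnits v))} (hφ : φ ∈ ismGenuine v)
  {ψ : v.adicCompletion F ≃+ v.adicCompletion F} (hψ : Realises v L φ ψ)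

include hφ hψ

/-- **SUB-LATTICE RIGIDITY**: for `ψ` realising a `G_v`-isometry `φ` through `L` and an additive subgroup
`M ⊆ L(𝒪_v^×)` whose unit preimage `{u : L u ∈ M}` has open image in `K_v^×`: `ψ(M) = M`.  With the analytic
logarithm every `M ⊇ p^m · log_v(𝒪_v^×)` qualifies (its unit preimage contains the open subgroup `(𝒪_v^×)^{p^m}`), so a
print isometry preserves EVERY finite-index sub-lattice of the log-lattice — it acts on `log_v(𝒪_v^×) ⧸ p^m` by a map
fixing all subgroups (a scalar), never by a shear. [cite: SerreLocalFields1979, Ch. XIV §6 Thm. 1] [claim: Mochizuki2012, status: disputed] -/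
theorem image_eq_of_realises_of_le_range (M : AddSubgroup (v.adicCompletion F))
    (hM : (M : Set (v.adicCompletion F)) ⊆ Set.range fun u : (↥(v.adicCompletionIntegers F))ˣ => L (Additive.ofMul u))
    (hopen : IsOpen (((unitPreimage L M).map (unitsToK v) : Set (v.adicCompletion F)ˣ))) :
    ψ '' (M : Set (v.adicCompletion F)) = M := by
  have hLM : (fun u : (↥(v.adicCompletionIntegers F))ˣ => L (Additive.ofMul u)) ''
      ((unitPreimage L M : Subgroup _) : Set (↥(v.adicCompletionIntegers F))ˣ) = (M : Set (v.adicCompletion F)) := by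
    apply Set.Subset.antisymm
    · rintro _ ⟨u, hu, rfl⟩
      exact (mem_unitPreimage_iff L M u).mp hu
    · intro a ha
      obtain ⟨u, rfl⟩ := hM ha
      exact ⟨u, (mem_unitPreimage_iff L M u).mpr ha, rfl⟩
  rw [← hLM]
  exact image_log_eq_of_realises hφ (unitPreimage L M) hopen L hψ

end Lattice

end Summit.ABC.IUTFork.Thm311.Real

end
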